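import Mathlib
import Summits.ValiantsHypothesis.ValiantsHypothesis.Theorems.BarrierLeverPartitionMinorsHitByVPHiddenStatesMatching
import Summits.ValiantsHypothesis.ValiantsHypothesis.Theorems.BarrierLeverPartitionMinorsHitByVPHiddenStatesLowerToAll

/-!
# Route BarrierLever — item `PartitionMinorsHitByVP` (stmt-ValiantsHypothesis-19717), line `hidden_states`:
# THE MATCHING PIECE IS UNIFORM — the one-piece block-additive matrix with the origin column, every injective row family

Helper file (`--supports stmt-ValiantsHypothesis-19717`; cell valiant-natproofs, rung V4, 𝒟-side door (c); prover seat
val-np-p3 gen 20). Definition-free. Closes NO item. Memo HOME/val-np-p3/g20/MEMO-blockpeeling-valnp3-g20.md §5.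

The matching theorem (`Matching.exists_table_of_isMatching`, part 2) is stated for the zero-base configuration matrix
`PairBlock.cfgMat` without the origin column. Here it is brought to the shape of the line's one-piece stubs,
`[∏_{c ∈ u i} (tx none c + Σ_{q ∈ cols k} tx (some q) c)]_{i,k}` with a column family `cols : Fin (n+1) → Finset (Fin K)`
consisting of ONE empty column (the origin) and a matching family on the other `n` columns:

* `exists_table_lower` — for every injective row family with LOWER-SET range (a down-set; it contains `∅`) there is a table
  with base point `tx none = 0`: the origin column is then the unit vector at the row `∅`, and Laplace expansion along it
  (`Matrix.det_succ_column`) leaves exactly the configuration matrix of part 2 on the other rows.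
* **`exists_table` (UNIFORMITY)** — hence, by `LowerToAll.good_of_lower_onePiece` (p-val-np-p6 g15: lower sets suffice for any
  one-piece design), a table exists for EVERY injective row family `u : Fin (n+1) → Finset (Fin h)`: the matching piece
  «origin + singletons + `p` disjoint pairs» with `h + 3p ≤ n + 2` is UNIFORM at ambient `h`.

STATUS: the matching piece is not a threshold family, so this is not a registered stub; it is the uniform-piece input of the
gadget door of the block-peeling programme (memo §6–§7). WHAT THIS IS NOT: item 19717 stays OPEN; nothing on crux 14610 or
VP ≠ VNP.
-/

set_option linter.dupNamespace false

namespace Summit.ValiantsHypothesis.ValiantsHypothesis.Theorems.BarrierLever.HiddenStates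

open Finset Matrix

noncomputable section

namespace Matching

open PairBlock

variable {h K n : ℕ}

/-- **Down-sets, base point `0`.** One empty column (the origin) plus a matching family with `p` pairs and `h + 3p ≤ n + 2`:
for every injective row family with lower-set range some table with base point `0` makes the one-piece block-additive matrix
nonsingular. -/
theorem exists_table_lower (cols : Fin (n + 1) → Finset (Fin K)) (k₀ : Fin (n + 1)) (hk₀ : cols k₀ = ∅)
    (hM : IsMatching (fun x : Fin n => cols (k₀.succAbove x))) {p : ℕ}
    (hp : numPairs (fun x : Fin n => cols (k₀.succAbove x)) = p) (hslack : h + 3 * p ≤ n + 2)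
    (v : Fin (n + 1) → Finset (Fin h)) (hv : Function.Injective v) (hlow : IsLowerSet (Set.range v)) :
    ∃ tx : Option (Fin K) → Fin h → ℂ,
      (Matrix.of fun i k : Fin (n + 1) => ∏ c ∈ v i, (tx none c + ∑ q ∈ cols k, tx (some q) c)).det ≠ 0 := by
  classical
  obtain ⟨i₀, hi₀⟩ : ∃ i₀, v i₀ = ∅ :=
    hlow (show (∅ : Finset (Fin h)) ≤ v 0 from Finset.empty_subset _) ⟨0, rfl⟩
  -- the other rows
  set ℛ : Fin n → Finset (Fin h) := fun x => v (i₀.succAbove x) with hℛ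
  have hℛinj : Function.Injective ℛ := fun x x' hxx' => Fin.succAbove_right_injective (hv hxx')
  obtain ⟨g, hg⟩ := exists_table_of_isMatching p (fun x : Fin n => cols (k₀.succAbove x)) hM hp ℛ hℛinj hslack
  refine ⟨fun o c => o.elim 0 (fun q => g q c), ?_⟩
  set A : Matrix (Fin (n + 1)) (Fin (n + 1)) ℂ := Matrix.of fun i k : Fin (n + 1) =>
    ∏ c ∈ v i, ((fun o c => Option.elim o (0 : ℂ) (fun q => g q c)) none c +
      ∑ q ∈ cols k, (fun o c => Option.elim o (0 : ℂ) (fun q => g q c)) (some q) c) with hA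
  -- the origin column is the unit vector at the row `i₀`
  have hcol : ∀ i, A i k₀ = if i = i₀ then 1 else 0 := by
    intro i
    simp only [hA, Matrix.of_apply, hk₀, Finset.sum_empty, Option.elim, add_zero]
    by_cases hi : i = i₀
    · rw [if_pos hi, hi, hi₀, Finset.prod_empty]
    · rw [if_neg hi]
      have hne : (v i).Nonempty := by
        rw [Finset.nonempty_iff_ne_empty]
        intro hemp
        exact hi (hv (hemp.trans hi₀.symm))
      obtain ⟨c, hc⟩ := hne
      exact Finset.prod_eq_zero hc rfl
  -- the minor at `(i₀, k₀)` is the configuration matrix of the other rows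
  have hminor : A.submatrix i₀.succAbove k₀.succAbove = cfgMat ℛ (fun x : Fin n => cols (k₀.succAbove x)) g := by
    refine Matrix.ext fun x x' => ?_
    simp [hA, cfgMat, Matrix.submatrix_apply, hℛ]
  have hdet : A.det = (-1) ^ ((i₀ : ℕ) + (k₀ : ℕ)) * (cfgMat ℛ (fun x : Fin n => cols (k₀.succAbove x)) g).det := by
    rw [Matrix.det_succ_column A k₀, Finset.sum_eq_single i₀]
    · rw [hcol, if_pos rfl, mul_one, hminor]
    · intro i _ hi
      rw [hcol, if_neg hi, mul_zero, zero_mul]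
    · intro hi
      exact absurd (Finset.mem_univ i₀) hi
  show A.det ≠ 0
  rw [hdet]
  exact mul_ne_zero (pow_ne_zero _ (by norm_num)) hg

/-- **UNIFORMITY OF THE MATCHING PIECE.** One empty column plus a matching family with `p` pairs and `h + 3p ≤ n + 2`: for
EVERY injective row family `u : Fin (n+1) → Finset (Fin h)` some table makes the one-piece block-additive matrix nonsingular
(lower sets suffice, `LowerToAll.good_of_lower_onePiece`). -/
theorem exists_table (cols : Fin (n + 1) → Finset (Fin K)) (k₀ : Fin (n + 1)) (hk₀ : cols k₀ = ∅)
    (hM : IsMatching (fun x : Fin n => cols (k₀.succAbove x))) {p : ℕ}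
    (hp : numPairs (fun x : Fin n => cols (k₀.succAbove x)) = p) (hslack : h + 3 * p ≤ n + 2)
    (u : Fin (n + 1) → Finset (Fin h)) (hu : Function.Injective u) :
    ∃ tx : Option (Fin K) → Fin h → ℂ,
      (Matrix.of fun i k : Fin (n + 1) => ∏ c ∈ u i, (tx none c + ∑ q ∈ cols k, tx (some q) c)).det ≠ 0 :=
  LowerToAll.good_of_lower_onePiece cols
    (fun v hv hlow => exists_table_lower cols k₀ hk₀ hM hp hslack v hv hlow) u hu

end Matching

end

end Summit.ValiantsHypothesis.ValiantsHypothesis.Theorems.BarrierLever.HiddenStates
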